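import Literature.Barriers.ValiantsHypothesis.KRST2022AsPrinted
import Literature.Barriers.ValiantsHypothesis.CKRST20NaturalProofsExist
import Literature.Computability.AlgebraicComplexity.BooleanSumDegreeTruncation
import HarnessLib

/-!
# KRST 2022 Main Theorem in its general degree regime `d ≤ n`, `N = binom(n + d, n)` — PROVED
# (Kumar–Ramya–Saptharishi–Tengse, *If VNP is hard, then so are equations for it*, STACS 2022 =
# arXiv:2012.07056; val-lit t21; source `paper:arxiv-2012.07056`; bib `KumarRamyaSaptharishiTengse2022`)

Typed literature and bookkeeping; `VP ≠ VNP` is NOT proved and nothing here is progress on it.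

The cell's CHECK file `KRST2022AsPrinted.lean` (row KRST2022-A) proves the displayed Main Theorem
(arXiv p0003 chunk L55–59 = STACS Thm 2) in the regime `d = n`, `N = binom(2n, n)`, and records
in its module table the printed clause "any `d ≤ n` and `N = binom(n+d, n)`" as
"INSTANCE ONLY — TODO(general form): `d < n` is the same proof with the truncation `F^{≤ d}`
(print: 'by standard homogenisation arguments'); needs closure of `SmallDefinable` under degree
truncation, not in tree". This file supplies that closure and the general-`d` theorem:

* `truncation_mem_vnpSlice` — CKRST's fixed-`n` slice of `VNP` (`vnpSlice F n d₀ t`: degree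
  `≤ d₀` Boolean sums `Σ_e g(x,e)` with `≤ t` Boolean variables, `L(g), deg g ≤ t`) is closed under
  the degree-`≤ d` truncation `f ↦ Σ_{i ≤ d} f^{(i)}` at the cost `t ↦ (d₀ + 1)(t + n + 2)`, over any
  field with `d₀ + 1` distinct elements (`BoolSumTrunc.exists_boolSum_eq_truncation`,
  `Literature/Computability/AlgebraicComplexity/BooleanSumDegreeTruncation.lean`);
  `truncation_mem_vnpSlice_charZero`, `truncation_mem_vnpSlice_of_infinite` (any characteristic);
  `truncation_smallDefinable_mem_vnpSlice` — for
  `f ∈ SmallDefinable F n b` ("`VNP(n, n)`" at size `n^b`) and `d ≤ n`, `4 ≤ n`: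
  `Σ_{i ≤ d} f^{(i)} ∈ vnpSlice F n d (n^{b+4})` ("`VNP(n, d)`" at size `n^{b+4}`);
* `IsSuccinctHittingSet.vnpSlice_of_smallDefinable` — the frame transfer `d = n ⟹ d ≤ n` at one
  level `n ≥ 4`: rename a degree-`d` distinguisher into the `d = n` frame (`N_d ≤ N_n`), hit it, truncate;
* **`KRST2022_mainThm_pointwise_degLE`** — for every `c` (`ε = 1/c`) ONE `VNP`-size exponent `b`
  such that for every distinguisher level `a`, all large `n`, EVERY `d ≤ n` and every
  `m < (n+1)^{4c}`: if `2^{n^4} ≤ L(per_m)` then the coefficient vectors (on the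
  `N = binom(n+d, n)` monomials of degree `≤ d`, `monomialsDegLE n d`) of `vnpSlice F n d (n^b)` hit
  every nonzero `P` in `N` variables of size and degree `≤ N^a`;
* **`KRST2022_mainThm_asPrinted_degLE`** — the displayed sentence with "any `d ≤ n`,
  `N = binom(n+d, n)`": every nonzero `P(x_1, …, x_N)` of degree `≤ N^a` vanishing on all coefficient
  vectors of `VNP(n, d)` (= `vnpSlice F n d (n^b)`) has `N^a < size(P)`, eventually in `n`,
  uniformly in `d ≤ n`;
At `d = n` the statements specialise DEFINITIONALLY to the CHECK file's shapes
(`monomialsDegLE n n = degLEMonomials n`, `vnpSlice F n n (n^b) = SmallDefinable F n b`, both `rfl`;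
`binom(n+n, n) = binom(2n, n)`), i.e. to `KRST2022_mainThm_asPrinted` — not restated here.

* `succinctHittingSetsFromVNP_degLE_of_permanentExpHard` (almost-everywhere hardness
  `PermanentExpHardWith`) and `succinctHittingSetsFromVNP_io_degLE_of_permanentExpHardIO`
  (infinitely-often hardness `PermanentExpHardIO`, the printed reading of §3.5's concluding
  paragraph) — the two asymptotic forms, every `d ≤ n`.

* BEYOND PRINT (§Padding, disclosed as a generalisation): `killCompl_castLE_mem_vnpSlice`,
  `IsSuccinctHittingSet.vnpSlice_of_smallDefinable_pad` (hitting at level `d` of the `d = n` frame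
  ⟹ hitting at `(n, d)` for `n ≤ d`, by padding variables; any field) and
  `succinctHittingSetsFromVNP_allDegrees_of_permanentExpHard` — under almost-everywhere hardness,
  `VNP(n, d)` at size `(n+d)^b` hits at EVERY `(n, d)`, no upper bound on `d` (print: `d ≤ n`);
  `KRST2022_not_equations_VNP_anyDegree` — family form in Def. 4 words: for every degree function
  `d(n)` and level `a`, no family of nonzero `poly(N)`-size/degree polynomials vanishes eventually on
  `VNP(n, d(n))` for every size exponent (the `d(n) = n` instance is the CHECK file's
  `KRST2022_not_hasEfficientEquations_VNP`).

Proof route and its ONE deviation from print. Print (§3.5, p0008 L40–59) runs the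
Kabanets–Impagliazzo argument directly at `N = binom(n+d, n)`: the coefficient vector of the
truncated generator polynomial `F^{≤d}_{n,n,p}` IS the KI generator, and `F^{≤d}_{n,n,p} ∈ VNP` "by
standard homogenisation arguments" (L42–43). Here the truncation step is proved as stated
(`BoolSumTrunc`, interpolation of homogeneous components inside the Boolean sum, explicit size
`(D+1)(L(g)+n+2)`), but the KI step is NOT re-run at `N_d = binom(n+d,n)`: a nonzero degree-`d`
distinguisher `P` of size and degree `≤ N_d^a` is renamed along the inclusion
`monomialsDegLE n d ⊆ degLEMonomials n` into the `d = n` frame, where it is a level-`a` distinguisher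
because `N_d ≤ N_n = binom(2n, n)` (`complexity_rename_of_injective_holds`, `totalDegree_rename_le`);
the tree's `d = n` engine (`KRST2022_mainThm_pointwise`) produces `f ∈ SmallDefinable F n b₁` with
`P(coeff_{≤d}(f)) ≠ 0`, and `coeff_{≤d}(f) = coeff_{≤d}(f^{≤d})` with `f^{≤d} ∈ vnpSlice F n d (n^b)`.
Same statement, same hypotheses (`2^{n^4} ≤ L(per_m)`, `m < (n+1)^{4c}`, characteristic `0`), the
conclusion `N_d^a < size(P)` for every `a` eventually — i.e. `size(P) = N^{ω(1)}` with the degree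
clause of the printed proof (module docstring of `KRST2022AsPrinted.lean`, erratum note; unchanged).
Small `d` (e.g. `d ≤ 1`, where `VNP(n, d)` fills the coefficient space and no nonzero equation
exists) are covered vacuously, as in print.

0 named facts; theorems only (no new definitions). Honest framing: a 2022 conditional barrier
theorem about equations for `VNP`, now typed in its printed generality; nothing here bears on
`VP ≠ VNP`, which is NOT proved; rung V4 (`SuccinctHittingSetsForVP`, `KRSTForVP`, …) untouched.

## References

* [KumarRamyaSaptharishiTengse2022] M. Kumar, C. Ramya, R. Saptharishi, A. Tengse, *If VNP is hard,
  then so are equations for it*, STACS 2022, LIPIcs 219, 44:1–44:13 (arXiv:2012.07056v1): Main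
  Theorem (p0003 chunk L55–59), Def. 3 `VNP(n,d)` (p0006 L26–35), §3.5 proof (p0008 L36–59, the
  truncation `F^{≤d}_{n,n,p}` at L42–43), concluding paragraph (p0008 L67).
* [ChatterjeeKumarRamyaSaptharishiTengse2020] P. Chatterjee, M. Kumar, C. Ramya, R. Saptharishi,
  A. Tengse, FOCS 2020 (arXiv:2004.14147), Def. 1.2 (`x^{≤d}`, `N = binom(n+d,n)`), Def. 2.3 (the
  slice `VNP(n,d)` = the tree's `vnpSlice`).
* [Burgisser2000] P. Bürgisser, *Completeness and Reduction in Algebraic Complexity Theory*,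
  Springer 2000, §2.1 (interpolation of homogeneous components), Rem. 2.2 (renaming variables).
-/

noncomputable section

namespace Literature.Barriers.ValiantsHypothesis

open Literature.Computability.AlgebraicComplexity Literature.Computability.MetaComplexity
  MvPolynomial

/-! ### Degree truncation inside the slices `VNP(n, d)` -/

section Truncation

variable {F : Type*} [Field F]

/-- Monotonicity of the `VNP` slice in the size parameter. [folklore] -/
private theorem vnpSlice_mono_right {n d t t' : ℕ} (h : t ≤ t') :
    vnpSlice F n d t ⊆ vnpSlice F n d t' := by
  rintro f ⟨hdeg, m, hm, g, hgc, hgd, hfg⟩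
  exact ⟨hdeg, m, hm.trans h, g, hgc.trans h, hgd.trans h, hfg⟩

/-- **`VNP(n, d₀)` is closed under degree truncation, with explicit cost** (the "standard
homogenisation arguments" of the printed proof, slice form): over a field with `d₀ + 1` distinct
elements `v`, for `f ∈ vnpSlice F n d₀ t` and `d ≤ d₀`, the truncation `Σ_{i ≤ d} f^{(i)}` lies in
`vnpSlice F n d ((d₀ + 1) · (t + n + 2))` (same number of Boolean variables; witness =
`BoolSumTrunc.truncWitness`). [cite: KumarRamyaSaptharishiTengse2022, §3.5 (proof of the Main Theorem, `F^{≤d}_{n,n,p} ∈ VNP`)]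
locator: paper:arxiv-2012.07056 chunk p0008.txt:L42–43 -/
theorem truncation_mem_vnpSlice {n d₀ t d : ℕ} {v : Fin (d₀ + 1) → F}
    (hv : Function.Injective v) (hd : d ≤ d₀) {f : MvPolynomial (Fin n) F}
    (hf : f ∈ vnpSlice F n d₀ t) :
    ∑ i ∈ Finset.range (d + 1), homogeneousComponent i f ∈
      vnpSlice F n d ((d₀ + 1) * (t + n + 2)) := by
  obtain ⟨hdeg, u, hu, g, hgc, hgd, rfl⟩ := hf
  obtain ⟨W, hWc, hWd, hW⟩ :=
    BoolSumTrunc.exists_boolSum_eq_truncation hd hv g hgc hgd hdeg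
  have ht : t ≤ (d₀ + 1) * (t + n + 2) := by nlinarith
  exact ⟨BoolSumTrunc.totalDegree_sum_homogeneousComponent_le _ d, u, hu.trans ht, W, hWc,
    hWd.trans ht, hW⟩

/-- Characteristic zero: `truncation_mem_vnpSlice` with the nodes `0, 1, …, d₀`.
[cite: KumarRamyaSaptharishiTengse2022, §3.5 (proof of the Main Theorem) and Remark 1 (characteristic zero)]
locator: paper:arxiv-2012.07056 chunk p0008.txt:L42–43, p0004.txt:L1–2 -/
theorem truncation_mem_vnpSlice_charZero [CharZero F] {n d₀ t d : ℕ} (hd : d ≤ d₀)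
    {f : MvPolynomial (Fin n) F} (hf : f ∈ vnpSlice F n d₀ t) :
    ∑ i ∈ Finset.range (d + 1), homogeneousComponent i f ∈
      vnpSlice F n d ((d₀ + 1) * (t + n + 2)) := by
  have hv : Function.Injective (fun j : Fin (d₀ + 1) => ((j : ℕ) : F)) := by
    intro a b h
    have h' : ((a : ℕ) : F) = ((b : ℕ) : F) := h
    exact Fin.ext (Nat.cast_injective h')
  exact truncation_mem_vnpSlice hv hd hf

/-- Infinite fields (any characteristic): `truncation_mem_vnpSlice` with `d₀ + 1` distinct nodes
taken from an embedding `ℕ ↪ F`. [cite: KumarRamyaSaptharishiTengse2022, §3.5 (proof of the Main Theorem, `F^{≤d}_{n,n,p} ∈ VNP`)]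
locator: paper:arxiv-2012.07056 chunk p0008.txt:L42–43 -/
theorem truncation_mem_vnpSlice_of_infinite [Infinite F] {n d₀ t d : ℕ} (hd : d ≤ d₀)
    {f : MvPolynomial (Fin n) F} (hf : f ∈ vnpSlice F n d₀ t) :
    ∑ i ∈ Finset.range (d + 1), homogeneousComponent i f ∈
      vnpSlice F n d ((d₀ + 1) * (t + n + 2)) := by
  have hv : Function.Injective (fun j : Fin (d₀ + 1) => Infinite.natEmbedding F (j : ℕ)) :=
    fun a b h => Fin.ext ((Infinite.natEmbedding F).injective h)
  exact truncation_mem_vnpSlice hv hd hf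

/-- Arithmetic: `(n + 1)(n^b + n + 2) ≤ n^{b+4}` for `n ≥ 4`. [folklore] -/
private theorem succ_mul_le_pow (b n : ℕ) (hn : 4 ≤ n) :
    (n + 1) * (n ^ b + n + 2) ≤ n ^ (b + 4) := by
  have h1 : 1 ≤ n ^ b := Nat.one_le_pow _ _ (by omega)
  have h2 : n + 2 ≤ n ^ 2 := by nlinarith
  have h3 : n ^ 2 ≤ n ^ (b + 2) := Nat.pow_le_pow_right (by omega) (by omega)
  have h4 : n ^ b ≤ n ^ (b + 2) := Nat.pow_le_pow_right (by omega) (by omega)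
  have h5 : n ^ b + n + 2 ≤ 2 * n ^ (b + 2) := by omega
  have h6 : n + 1 ≤ 2 * n := by omega
  calc (n + 1) * (n ^ b + n + 2) ≤ (2 * n) * (2 * n ^ (b + 2)) := Nat.mul_le_mul h6 h5
    _ = 4 * (n ^ (b + 2) * n) := by ring
    _ ≤ n * (n ^ (b + 2) * n) := Nat.mul_le_mul_right _ hn
    _ = n ^ (b + 4) := by ring

/-- **From `VNP(n, n)` to `VNP(n, d)`**: for `f ∈ SmallDefinable F n b` (KRST Def. 3 at `d = n`,
size `n^b`), `d ≤ n` and `n ≥ 4`, the truncation `Σ_{i ≤ d} f^{(i)}` lies in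
`vnpSlice F n d (n^{b+4})` (characteristic zero).
[cite: KumarRamyaSaptharishiTengse2022, §3.5 (proof of the Main Theorem, `F^{≤d}_{n,n,p} ∈ VNP`) and Def. 3]
locator: paper:arxiv-2012.07056 chunk p0008.txt:L42–43, p0006.txt:L26–35 -/
theorem truncation_smallDefinable_mem_vnpSlice [CharZero F] {n b d : ℕ} (hn : 4 ≤ n) (hd : d ≤ n)
    {f : MvPolynomial (Fin n) F} (hf : f ∈ SmallDefinable F n b) :
    ∑ i ∈ Finset.range (d + 1), homogeneousComponent i f ∈ vnpSlice F n d (n ^ (b + 4)) := by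
  rw [smallDefinable_eq_vnpSlice] at hf
  exact vnpSlice_mono_right (succ_mul_le_pow b n hn) (truncation_mem_vnpSlice_charZero hd hf)

/-- Coefficient vectors on the degree-`≤ d` monomials do not see the terms of degree `> d`: `f` and
its truncation `Σ_{i ≤ d} f^{(i)}` have the same `coeff_{x^{≤ d}}`. [cite: ChatterjeeKumarRamyaSaptharishiTengse2020, Def. 1.2] -/
theorem coeffVector_monomialsDegLE_truncation {n d : ℕ} (f : MvPolynomial (Fin n) F) :
    coeffVector (monomialsDegLE n d) (∑ i ∈ Finset.range (d + 1), homogeneousComponent i f) =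
      coeffVector (monomialsDegLE n d) f := by
  funext m
  simp only [coeffVector_apply]
  exact BoolSumTrunc.coeff_sum_homogeneousComponent_of_le f m.2

end Truncation

/-! ### The Main Theorem for every `d ≤ n` -/

section MainTheorem

variable {F : Type*} [Field F] [CharZero F]

/-- The degree-`≤ d` monomials are degree-`≤ n` monomials when `d ≤ n`. [folklore] -/
private theorem monomialsDegLE_subset_degLEMonomials {n d : ℕ} (hd : d ≤ n) :
    monomialsDegLE n d ⊆ degLEMonomials n :=
  fun _ hm => le_trans hm hd

/-- `N_d = binom(n + d, n) ≤ binom(2n, n) = N_n` for `d ≤ n`. [folklore] -/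
private theorem choose_add_le_choose_two_mul {n d : ℕ} (hd : d ≤ n) :
    (n + d).choose n ≤ (2 * n).choose n := by
  rw [two_mul]
  exact Nat.choose_le_choose n (by omega)

/-- **Frame transfer `d = n ⟹ d ≤ n`.** If at level `n ≥ 4` the coefficient vectors of
`SmallDefinable F n b` ("`VNP(n, n)`") hit every nonzero level-`a` distinguisher in the
`binom(2n, n)` coefficient variables, then for every `d ≤ n` the coefficient vectors on `x^{≤ d}` of
`vnpSlice F n d (n^{b+4})` ("`VNP(n, d)`") hit every nonzero polynomial in the `N = binom(n+d, n)`
coefficient variables of size and degree `≤ N^a`: rename a degree-`d` distinguisher along the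
inclusion `monomialsDegLE n d ⊆ degLEMonomials n` (size preserved, `complexity_rename_of_injective_holds`;
degree not increased; `N_d ≤ N_n`), hit it by some `f ∈ SmallDefinable F n b`, and truncate `f` to
degree `≤ d` (`truncation_smallDefinable_mem_vnpSlice`; the coefficients on `x^{≤ d}` are unchanged,
`coeffVector_monomialsDegLE_truncation`). This is the tree's form of the printed reduction
"`F^{≤d}_{n,n,p}` … its coefficient vector is precisely the KI generator" for `d ≤ n`.
[cite: KumarRamyaSaptharishiTengse2022, §3.5 (proof of the Main Theorem)]
locator: paper:arxiv-2012.07056 chunk p0008.txt:L42–49 -/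
theorem IsSuccinctHittingSet.vnpSlice_of_smallDefinable {n b a d : ℕ} (hn : 4 ≤ n) (hdn : d ≤ n)
    (h : IsSuccinctHittingSet (degLEMonomials n) (SmallDefinable F n b) (Distinguishers F n a)) :
    IsSuccinctHittingSet (monomialsDegLE n d) (vnpSlice F n d (n ^ (b + 4)))
      {P : MvPolynomial (monomialsDegLE n d) F |
        complexity P ≤ ((n + d).choose n) ^ a ∧ P.totalDegree ≤ ((n + d).choose n) ^ a} := by
  intro P hP hP0
  -- transport `P` into the `d = n` frame
  set ι : monomialsDegLE n d → degLEMonomials n :=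
    Set.inclusion (monomialsDegLE_subset_degLEMonomials hdn) with hι_def
  have hι : Function.Injective ι := Set.inclusion_injective _
  have hP'0 : rename ι P ≠ 0 := fun h0 => hP0 (rename_injective ι hι (by rw [h0, map_zero]))
  have hN := choose_add_le_choose_two_mul hdn
  have hmem : rename ι P ∈ Distinguishers F n a := by
    refine ⟨?_, ?_⟩
    · rw [complexity_rename_of_injective_holds hι P]
      exact hP.1.trans (Nat.pow_le_pow_left hN a)
    · exact (totalDegree_rename_le _ _).trans (hP.2.trans (Nat.pow_le_pow_left hN a))
  obtain ⟨f, hf, hne⟩ := h (rename ι P) hmem hP'0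
  -- truncate the hitting polynomial to degree `≤ d`
  refine ⟨∑ i ∈ Finset.range (d + 1), homogeneousComponent i f,
    truncation_smallDefinable_mem_vnpSlice hn hdn hf, ?_⟩
  rw [coeffVector_monomialsDegLE_truncation]
  rwa [eval_rename] at hne

/-- **KRST Main Theorem, POINTWISE form, for EVERY `d ≤ n` — PROVED.** For every `c` (`ε = 1/c`)
there is ONE `VNP`-size exponent `b` such that for every distinguisher level `a`, all large `n`,
every `d ≤ n` and every `m < (n+1)^{4c}` (print: `n = ⌊m^{ε/4}⌋`): IF `2^{n^4} ≤ L(per_m)` THEN the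
coefficient vectors on `x^{≤ d}` (`N = binom(n+d, n)` coordinates) of the slice
`VNP(n, d)` = `vnpSlice F n d (n^b)` hit every nonzero `P` in the `N` coefficient variables of size
and degree `≤ N^a`. The `d = n` instance is the CHECK file's `KRST2022_mainThm_pointwise`; this is
the printed "any `d ≤ n`" (by `IsSuccinctHittingSet.vnpSlice_of_smallDefinable`).
[cite: KumarRamyaSaptharishiTengse2022, Thm MainThm (= STACS Thm 2) and §3.5]
locator: paper:arxiv-2012.07056 chunk p0003.txt:L55–59 (statement, "any d ≤ n and N = binom(n+d,n)"), p0008.txt:L36–59 (proof) -/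
theorem KRST2022_mainThm_pointwise_degLE (c : ℕ) :
    ∃ b : ℕ, ∀ a : ℕ, ∃ n₀ : ℕ, ∀ n : ℕ, n₀ ≤ n → ∀ d : ℕ, d ≤ n →
      ∀ m : ℕ, m < (n + 1) ^ (4 * c) → 2 ^ (n ^ 4) ≤ complexity (perPoly (Fin m) F) →
        IsSuccinctHittingSet (monomialsDegLE n d) (vnpSlice F n d (n ^ b))
          {P : MvPolynomial (monomialsDegLE n d) F |
            complexity P ≤ ((n + d).choose n) ^ a ∧ P.totalDegree ≤ ((n + d).choose n) ^ a} := by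
  obtain ⟨b₁, hb₁⟩ := KRST2022_mainThm_pointwise (F := F) c
  refine ⟨b₁ + 4, fun a => ?_⟩
  obtain ⟨n₁, hn₁⟩ := hb₁ a
  refine ⟨max n₁ 4, fun n hn d hdn m hm hhard => ?_⟩
  exact (hn₁ n ((le_max_left _ _).trans hn) m hm hhard).vnpSlice_of_smallDefinable
    ((le_max_right _ _).trans hn) hdn

/-- **KRST 2022 Main Theorem AS PRINTED, general degree regime — PROVED.** "Let `ε > 0` be a
constant. Suppose, for an `m` large enough, we have that `Perm_m` requires circuits of size
`2^{m^ε}`. Then, for `n = m^{ε/4}`, ANY `d ≤ n` and `N = binom(n+d, n)`, we have that every nonzero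
polynomial `P(x_1, …, x_N)` that vanishes on all coefficient vectors of polynomials in `VNP_ℂ(n,d)`
has `size(P) = N^{ω(1)}`." Typed exactly as the CHECK file's `KRST2022_mainThm_asPrinted` (`ε = 1/c`,
`m < (n+1)^{4c}`, weaker hypothesis `2^{n^4} ≤ L(per_m)`, "`VNP(n,d)`" = `vnpSlice F n d (n^b)` for
ONE `b = b(c)`, conclusion `N^a < complexity P` for every `a` eventually, degree clause
`P.totalDegree ≤ N^a` per the printed proof — see that file's erratum note), now with the printed
quantifier "any `d ≤ n`" and `N = binom(n+d, n)` instead of the instance `d = n`.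
[cite: KumarRamyaSaptharishiTengse2022, Thm MainThm (= STACS Thm 2) with Remark and §3.5 concluding paragraph]
locator: paper:arxiv-2012.07056 chunk p0003.txt:L55–59, p0004.txt:L1–2, p0008.txt:L67 -/
theorem KRST2022_mainThm_asPrinted_degLE (c : ℕ) :
    ∃ b : ℕ, ∀ a : ℕ, ∃ n₀ : ℕ, ∀ n : ℕ, n₀ ≤ n → ∀ d : ℕ, d ≤ n →
      ∀ m : ℕ, m < (n + 1) ^ (4 * c) → 2 ^ (n ^ 4) ≤ complexity (perPoly (Fin m) F) →
        ∀ P : MvPolynomial (monomialsDegLE n d) F, P ≠ 0 →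
          P.totalDegree ≤ ((n + d).choose n) ^ a →
          (∀ f ∈ vnpSlice F n d (n ^ b), eval (coeffVector (monomialsDegLE n d) f) P = 0) →
            ((n + d).choose n) ^ a < complexity P := by
  obtain ⟨b, hb⟩ := KRST2022_mainThm_pointwise_degLE (F := F) c
  refine ⟨b, fun a => ?_⟩
  obtain ⟨n₀, hn₀⟩ := hb a
  refine ⟨n₀, fun n hn d hd m hm hhard P hP hdeg hvan => ?_⟩
  by_contra hsize
  obtain ⟨f, hf, hne⟩ := hn₀ n hn d hd m hm hhard P ⟨not_lt.1 hsize, hdeg⟩ hP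
  exact hne (hvan f hf)

/-- **Almost-everywhere form for every `d ≤ n`** (the tree's `succinctHittingSetsFromVNP_of_permanentExpHard`
transferred): if `2^j ≤ L(per_{j^c})` for all `j ≥ m₀`, then ONE `b` serves every level `a`, all
large `n` and every `d ≤ n`. [cite: KumarRamyaSaptharishiTengse2022, Thm MainThm and §3.5 (concluding paragraph, "for n = m^{ε/4} and any d ≤ n, the coefficient vectors of polynomials in VNP(n,d) form a hitting set")]
locator: paper:arxiv-2012.07056 chunk p0008.txt:L67 -/
theorem succinctHittingSetsFromVNP_degLE_of_permanentExpHard {c m₀ : ℕ}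
    (hper : PermanentExpHardWith F c m₀) :
    ∃ b : ℕ, ∀ a : ℕ, ∃ n₀ : ℕ, ∀ n : ℕ, n₀ ≤ n → ∀ d : ℕ, d ≤ n →
      IsSuccinctHittingSet (monomialsDegLE n d) (vnpSlice F n d (n ^ b))
        {P : MvPolynomial (monomialsDegLE n d) F |
          complexity P ≤ ((n + d).choose n) ^ a ∧ P.totalDegree ≤ ((n + d).choose n) ^ a} := by
  obtain ⟨b₁, hb₁⟩ := succinctHittingSetsFromVNP_of_permanentExpHard hper
  refine ⟨b₁ + 4, fun a => ?_⟩
  obtain ⟨n₁, hn₁⟩ := hb₁ a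
  refine ⟨max n₁ 4, fun n hn d hdn => ?_⟩
  exact (hn₁ n ((le_max_left _ _).trans hn)).vnpSlice_of_smallDefinable
    ((le_max_right _ _).trans hn) hdn

/-- **Infinitely-often form for every `d ≤ n`** (the printed reading of the concluding paragraph:
"`Perm_m` is `2^{m^ε}`-hard for infinitely many `m`", `PermanentExpHardIO F c`; the tree's
`succinctHittingSetsFromVNP_io_of_permanentExpHardIO` transferred): ONE `b` such that for every
level `a` there are infinitely many `n` at which, for EVERY `d ≤ n`, `VNP(n, d)` at size `n^b` hits
every nonzero `P` of size and degree `≤ binom(n+d, n)^a`.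
[cite: KumarRamyaSaptharishiTengse2022, §3.5 (concluding paragraph)]
locator: paper:arxiv-2012.07056 chunk p0008.txt:L63–69 -/
theorem succinctHittingSetsFromVNP_io_degLE_of_permanentExpHardIO {c : ℕ}
    (hper : PermanentExpHardIO F c) :
    ∃ b : ℕ, ∀ a n₀ : ℕ, ∃ n : ℕ, n₀ ≤ n ∧ ∀ d : ℕ, d ≤ n →
      IsSuccinctHittingSet (monomialsDegLE n d) (vnpSlice F n d (n ^ b))
        {P : MvPolynomial (monomialsDegLE n d) F |
          complexity P ≤ ((n + d).choose n) ^ a ∧ P.totalDegree ≤ ((n + d).choose n) ^ a} := by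
  obtain ⟨b₁, hb₁⟩ := succinctHittingSetsFromVNP_io_of_permanentExpHardIO hper
  refine ⟨b₁ + 4, fun a n₀ => ?_⟩
  obtain ⟨n, hn, h⟩ := hb₁ a (max n₀ 4)
  exact ⟨n, (le_max_left _ _).trans hn, fun d hdn =>
    h.vnpSlice_of_smallDefinable ((le_max_right _ _).trans hn) hdn⟩

end MainTheorem

/-! ### Beyond print: the regime `d ≥ n` by padding variables (GENERALISATION, disclosed) -/

section Padding

variable {F : Type*} [Field F]

/-- **Substituting variables-or-constants of cost `0` into a `VNP(n', d₀)` slice member keeps the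
slice parameters** (`n'` free variables `↦` polynomials `θ w` in `n` variables of degree `≤ 1` and
complexity `0`): the Boolean sum commutes with the substitution (`boolSum_aeval_extend`), and the
witness `g(θ(x), e)` has size `≤ L(g)` and degree `≤ deg g`.
[cite: KumarRamyaSaptharishiTengse2022, Def. 3 (the slice `VNP(n,d)`)]
locator: paper:arxiv-2012.07056 chunk p0006.txt:L26–35 -/
theorem aeval_mem_vnpSlice_of_cost_zero {n n' d₀ t : ℕ} (θ : Fin n' → MvPolynomial (Fin n) F)
    (hθd : ∀ w, (θ w).totalDegree ≤ 1) (hθc : ∀ w, complexity (θ w) = 0)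
    {f : MvPolynomial (Fin n') F} (hf : f ∈ vnpSlice F n' d₀ t) :
    aeval θ f ∈ vnpSlice F n d₀ t := by
  obtain ⟨hdeg, u, hu, g, hgc, hgd, rfl⟩ := hf
  refine ⟨(totalDegree_aeval_le_of_le_one θ hθd _).trans hdeg, u, hu,
    aeval (Sum.elim (fun w => rename Sum.inl (θ w)) (fun j => X (Sum.inr j))) g, ?_, ?_,
    (boolSum_aeval_extend θ g).symm⟩
  · refine (complexity_aeval_le g _).trans ?_
    rw [Finset.sum_eq_zero, add_zero]
    · exact hgc
    · intro v _
      rcases v with w | j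
      · simp only [Sum.elim_inl]
        exact le_antisymm ((complexity_rename_le_holds' Sum.inl (θ w)).trans (hθc w).le)
          (Nat.zero_le _)
      · simp only [Sum.elim_inr]
        exact complexity_X_holds _
  · refine (totalDegree_aeval_le_of_le_one _ (fun v => ?_) g).trans hgd
    rcases v with w | j
    · simp only [Sum.elim_inl]
      exact (totalDegree_rename_le _ _).trans (hθd w)
    · simp only [Sum.elim_inr]
      exact (isHomogeneous_X F (Sum.inr j : Fin n ⊕ Fin u)).totalDegree_le

/-- **Killing padded variables keeps the `VNP` slice**: for `n ≤ n'` and `f ∈ vnpSlice F n' d₀ t`,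
`f(x_1, …, x_n, 0, …, 0)` (Mathlib's `killCompl` along `Fin.castLE`) lies in `vnpSlice F n d₀ t`.
[cite: KumarRamyaSaptharishiTengse2022, Def. 3 (the slice `VNP(n,d)`)]
locator: paper:arxiv-2012.07056 chunk p0006.txt:L26–35 -/
theorem killCompl_castLE_mem_vnpSlice {n n' d₀ t : ℕ} (hle : n ≤ n') {f : MvPolynomial (Fin n') F}
    (hf : f ∈ vnpSlice F n' d₀ t) :
    killCompl (Fin.castLE_injective hle) f ∈ vnpSlice F n d₀ t := by
  classical
  unfold killCompl
  refine aeval_mem_vnpSlice_of_cost_zero _ (fun w => ?_) (fun w => ?_) hf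
  · split_ifs
    · exact (isHomogeneous_X F _).totalDegree_le
    · simp
  · split_ifs
    · exact complexity_X_holds _
    · rw [← C_0]; exact complexity_C_holds _

/-- `binom(n + d, n) ≤ binom(2d, d)` for `n ≤ d`. [folklore] -/
private theorem choose_add_le_choose_two_mul_of_le' {n d : ℕ} (hnd : n ≤ d) :
    (n + d).choose n ≤ (2 * d).choose d := by
  rw [Nat.choose_symm_add, two_mul]
  exact Nat.choose_le_choose d (by omega)

/-- **Frame transfer by padding variables for the `VNP` slices (`n ≤ d`) — GENERALISATION beyond
the printed "any `d ≤ n`"**: if at level `d` the coefficient vectors of `SmallDefinable F d b`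
("`VNP(d, d)`") hit every nonzero level-`a` distinguisher (`binom(2d,d)` coefficient variables), then
at `(n, d)` with `n ≤ d` the coefficient vectors on `x^{≤ d}` of `vnpSlice F n d (d^b)` hit every
nonzero polynomial of size and degree `≤ binom(n+d,n)^a`: rename along the zero-extension of exponent
vectors `(Fin n →₀ ℕ) ↪ (Fin d →₀ ℕ)` (`binom(n+d,n) ≤ binom(2d,d)`), hit it, restrict the hitting
Boolean sum to the first `n` variables (`killCompl_castLE_mem_vnpSlice`, `coeff_killCompl`). Any
field (no truncation involved). [cite: KumarRamyaSaptharishiTengse2022, Thm MainThm and Def. 3 (typed beyond the printed range `d ≤ n`; see module docstring)]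
locator: paper:arxiv-2012.07056 chunk p0003.txt:L55–59, p0006.txt:L26–35 -/
theorem IsSuccinctHittingSet.vnpSlice_of_smallDefinable_pad {n d b a : ℕ} (hnd : n ≤ d)
    (h : IsSuccinctHittingSet (degLEMonomials d) (SmallDefinable F d b) (Distinguishers F d a)) :
    IsSuccinctHittingSet (monomialsDegLE n d) (vnpSlice F n d (d ^ b))
      {P : MvPolynomial (monomialsDegLE n d) F |
        complexity P ≤ ((n + d).choose n) ^ a ∧ P.totalDegree ≤ ((n + d).choose n) ^ a} := by
  intro P hP hP0
  have hf : Function.Injective (Fin.castLE hnd) := Fin.castLE_injective hnd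
  have hιmem : ∀ m : monomialsDegLE n d,
      Finsupp.mapDomain (Fin.castLE hnd) (m : Fin n →₀ ℕ) ∈ degLEMonomials d := by
    intro m
    show (Finsupp.mapDomain (Fin.castLE hnd) (m : Fin n →₀ ℕ)).degree ≤ d
    rw [Finsupp.degree_mapDomain]
    exact m.2
  set ι : monomialsDegLE n d → degLEMonomials d :=
    fun m => ⟨Finsupp.mapDomain (Fin.castLE hnd) (m : Fin n →₀ ℕ), hιmem m⟩ with hι_def
  have hι : Function.Injective ι := by
    intro m m' hmm'
    have h1 := congrArg Subtype.val hmm'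
    exact Subtype.ext (Finsupp.mapDomain_injective hf h1)
  have hP'0 : rename ι P ≠ 0 := fun h0 => hP0 (rename_injective ι hι (by rw [h0, map_zero]))
  have hN := choose_add_le_choose_two_mul_of_le' hnd
  have hmem : rename ι P ∈ Distinguishers F d a := by
    refine ⟨?_, ?_⟩
    · rw [complexity_rename_of_injective_holds hι P]
      exact hP.1.trans (Nat.pow_le_pow_left hN a)
    · exact (totalDegree_rename_le _ _).trans (hP.2.trans (Nat.pow_le_pow_left hN a))
  obtain ⟨f, hfm, hne⟩ := h (rename ι P) hmem hP'0
  refine ⟨killCompl hf f, ?_, ?_⟩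
  · rw [smallDefinable_eq_vnpSlice] at hfm
    exact killCompl_castLE_mem_vnpSlice hnd hfm
  · rw [eval_rename] at hne
    have hcv : coeffVector (monomialsDegLE n d) (killCompl hf f) =
        coeffVector (degLEMonomials d) f ∘ ι := by
      funext m
      simp only [coeffVector_apply, Function.comp_apply, hι_def]
      exact coeff_killCompl hf
    rwa [hcv]

variable [CharZero F]

/-- **Almost-everywhere hardness ⟹ `VNP(n, d)` hits at EVERY `(n, d)`, no upper bound on `d`
(GENERALISATION beyond the printed "any `d ≤ n`", disclosed):** if `2^j ≤ L(per_{j^c})` for all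
`j ≥ m₀`, then ONE `b` serves every level `a`, all large `n` and every `d`: the coefficient vectors on
`x^{≤ d}` of `vnpSlice F n d ((n + d)^b)` hit every nonzero `P` of size and degree `≤ binom(n+d,n)^a`.
For `d ≤ n` this is `succinctHittingSetsFromVNP_degLE_of_permanentExpHard` (truncation at level
`n`); for `d > n` the hard level is `d` itself (`≥ n ≥ n₀`) and the transfer is by padding
(`IsSuccinctHittingSet.vnpSlice_of_smallDefinable_pad`). The printed theorem asserts the range
`d ≤ n` only; the almost-everywhere hypothesis makes every large level hard, whence every `d`.
[cite: KumarRamyaSaptharishiTengse2022, Thm MainThm (range `d ≤ n` printed; `d > n` is this file's extension)]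
locator: paper:arxiv-2012.07056 chunk p0003.txt:L55–59 -/
theorem succinctHittingSetsFromVNP_allDegrees_of_permanentExpHard {c m₀ : ℕ}
    (hper : PermanentExpHardWith F c m₀) :
    ∃ b : ℕ, ∀ a : ℕ, ∃ n₀ : ℕ, ∀ n : ℕ, n₀ ≤ n → ∀ d : ℕ,
      IsSuccinctHittingSet (monomialsDegLE n d) (vnpSlice F n d ((n + d) ^ b))
        {P : MvPolynomial (monomialsDegLE n d) F |
          complexity P ≤ ((n + d).choose n) ^ a ∧ P.totalDegree ≤ ((n + d).choose n) ^ a} := by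
  obtain ⟨b₁, hb₁⟩ := succinctHittingSetsFromVNP_of_permanentExpHard hper
  refine ⟨b₁ + 4, fun a => ?_⟩
  obtain ⟨n₁, hn₁⟩ := hb₁ a
  refine ⟨max n₁ 4, fun n hn d => ?_⟩
  have h1 : n₁ ≤ n := (le_max_left _ _).trans hn
  have h4 : 4 ≤ n := (le_max_right _ _).trans hn
  rcases le_or_gt d n with hdn | hnd
  · exact ((hn₁ n h1).vnpSlice_of_smallDefinable h4 hdn).mono
      (vnpSlice_mono_right (Nat.pow_le_pow_left (Nat.le_add_right n d) _)) le_rfl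
  · refine ((hn₁ d (by omega)).vnpSlice_of_smallDefinable_pad hnd.le).mono
      (vnpSlice_mono_right ?_) le_rfl
    calc d ^ b₁ ≤ (n + d) ^ b₁ := Nat.pow_le_pow_left (Nat.le_add_left d n) _
      _ ≤ (n + d) ^ (b₁ + 4) := Nat.pow_le_pow_right (by omega) (by omega)

/-- **No efficiently constructible equations for `VNP` in ANY degree regime (family form, Def. 4
words, all degrees).** Under almost-everywhere hardness of the permanent, for every degree function
`d : ℕ → ℕ` (no upper bound) and every constructivity level `a`, there is NO family `P_n` of nonzero
polynomials in the `N = binom(n + d(n), n)` coefficient variables of size and degree `≤ N^a`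
(eventually) which, for every size exponent `b`, vanishes eventually on the coefficient vectors of
`VNP(n, d(n))` at size `(n + d(n))^b` (`vnpSlice`). The `d(n) = n` instance is the CHECK file's
`KRST2022_not_hasEfficientEquations_VNP` (`HasEfficientEquations` = this family notion at `d = n`);
the range `d(n) > n` is this file's generalisation beyond print (§Padding).
[cite: KumarRamyaSaptharishiTengse2022, Abstract, Def. 4 and §3.5 (concluding paragraph)]
locator: paper:arxiv-2012.07056 chunk p0002.txt:L3–4, p0006.txt:L39–43, p0008.txt:L63–69 -/
theorem KRST2022_not_equations_VNP_anyDegree {c m₀ : ℕ} (hper : PermanentExpHardWith F c m₀)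
    (d : ℕ → ℕ) (a : ℕ) (P : (n : ℕ) → MvPolynomial (monomialsDegLE n (d n)) F)
    (hP : ∃ n₁ : ℕ, ∀ n : ℕ, n₁ ≤ n → P n ≠ 0 ∧
      complexity (P n) ≤ ((n + d n).choose n) ^ a ∧ (P n).totalDegree ≤ ((n + d n).choose n) ^ a) :
    ¬ ∀ b : ℕ, ∃ n₀ : ℕ, ∀ n : ℕ, n₀ ≤ n →
      ∀ f ∈ vnpSlice F n (d n) ((n + d n) ^ b),
        eval (coeffVector (monomialsDegLE n (d n)) f) (P n) = 0 := by
  intro hvan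
  obtain ⟨b, hb⟩ := succinctHittingSetsFromVNP_allDegrees_of_permanentExpHard hper
  obtain ⟨n₂, hn₂⟩ := hb a
  obtain ⟨n₁, hn₁⟩ := hP
  obtain ⟨n₀, hn₀⟩ := hvan b
  have h0 : n₀ ≤ max (max n₀ n₁) n₂ := (le_max_left _ _).trans (le_max_left _ _)
  have h1 : n₁ ≤ max (max n₀ n₁) n₂ := (le_max_right _ _).trans (le_max_left _ _)
  have h2 : n₂ ≤ max (max n₀ n₁) n₂ := le_max_right _ _
  obtain ⟨hne, hc, hdeg⟩ := hn₁ _ h1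
  obtain ⟨f, hf, hfne⟩ := hn₂ _ h2 (d _) (P _) ⟨hc, hdeg⟩ hne
  exact hfne (hn₀ _ h0 f hf)

end Padding

end Literature.Barriers.ValiantsHypothesis

end
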